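import Literature.Analysis.FunctionSpaces.TorusCubeDescentRungs
import HarnessLib

/-!
# The flux into a rung of the descent ladder at a fixed time

Analysis/FunctionSpaces proof file (everything proved).  With the ladder of `TorusCubeDescentRungs` (`K₀ S Δ`, `2Δ ≤ S`,
rung weights `χ_ℓ = rungSym ℓ`, energies `E_ℓ`, projections `P_ℓ`), `abs_rungFlux_le` bounds the transport flux into the
`χ_ℓ²`-weighted energy of `u ∈ L²` along a continuous, weakly divergence-free, `Λ`-Lipschitz drift `b` whose sup-norm distance
to its Fourier truncation at radius `n S − 2Δ` is at most `W n`: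

  `|∫ ⟨u, (b·∇) P_{χ_ℓ²} u⟩| ≤ 2π (H_ℓ + 2Δ) √E_ℓ · [ (2d²Λ/Δ) √E_{ℓ−1} + d Σ_{i<ℓ−1} W(ℓ−1−i) √E_i + d W(ℓ) ‖u‖₂ ]`.

The previous rung feeds rung `ℓ` through the cube commutator (`TorusCubeFluxLocalisation.abs_cubeFlux_sub_remainder_le`,
Lipschitz constant only, derivative cost = band limit), rung `i < ℓ−1` only through the spectral tail of `b` beyond the gap
`(ℓ−1−i) S − 2Δ` and the rest of `u` through the tail beyond `ℓ S − 2Δ` (tail tool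
`abs_integral_mul_inner_realTrigPoly_le_of_coeff_vanish` + the spectral gaps of the pieces).  This is the fixed-time input of
the descent (band-kill) estimate for passive vector/tensor propagators; §13b adds the small tools the time integration uses
(`rungEnergy_eq_sum_mul`, `rungEnergy_le_integral_norm_sq`, `sum_smul_realTrigPoly_singleton` — the weighted test field of
`PassiveVectorTensorWeightedGalerkinIdentity` IS `realTrigPoly F (ω • X)` —, and the bookkeeping inequality `ladder_bracket_le`).  Consumer: cell `ad-ideate`, K1L_D
`stmt-AnomalousDissipation-27980`, `stub_effectiveFrameEnergyL_bandKill` (F-k3l-7).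
## Mathlib / tree search
Tree: `TorusCubeDescentRungs`, `TorusCubeFluxLocalisation`, `Torus.fourierTruncate_eq`, `Torus.neg_mem_freqBall_of_mem`.
Mathlib: `Finset.sum_range_sub'`, `abs_sub_abs_le_abs_sub`, `integral_finsetSum`.
## References
* R. J. DiPerna, P.-L. Lions, Invent. Math. 98 (1989), §II.1 Lemma II.1. [`DiPernaLions1989`]
* P. Constantin, W. E, E. S. Titi, Comm. Math. Phys. 165 (1994), (9)–(10). [`ConstantinETiti1994`] -/

noncomputable section

open MeasureTheory Set Filter Complex UnitAddTorus Function Finset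
open scoped ENNReal InnerProductSpace ComplexConjugate

namespace Literature.Analysis.FunctionSpaces
namespace Torus

variable {d : Type*} [Fintype d] [DecidableEq d]

/-! ## §13 The flux into rung `ℓ` is fed by the rungs above it -/

section RungFlux

open EuclideanSpace

variable {K₀ S Δ : ℕ}

/-- **THE FLUX INTO RUNG `ℓ ≥ 1` AT A FIXED TIME.**  For `u ∈ L²`, a continuous weakly divergence-free `Λ`-Lipschitz drift `b`
whose sup-norm distance to its Fourier truncation at radius `n S − 2Δ` is at most `W n` (`1 ≤ n ≤ ℓ`), the transport flux into the
`(rungSym ℓ)²`-weighted energy is at most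

  `2π (H_ℓ + 2Δ) √E_ℓ · [ (2d²Λ/Δ) √E_{ℓ−1} + d Σ_{i<ℓ−1} W(ℓ−1−i) √E_i + d W(ℓ) ‖u‖₂ ]`:

the previous rung feeds rung `ℓ` through the commutator (Lipschitz constant only), rung `i < ℓ − 1` only through the spectral tail
of `b` beyond the gap `(ℓ−1−i) S − 2Δ`, and the rest of `u` through the tail beyond `ℓ S − 2Δ`.
[cite: DiPernaLions1989, §II.1 Lemma II.1] -/
theorem abs_rungFlux_le (hΔ : 0 < Δ) (hS : 2 * Δ ≤ S) {ℓ : ℕ} (hℓ1 : 1 ≤ ℓ) (hℓ : ℓ * S ≤ K₀ + S)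
    {b : UnitAddTorus d → EuclideanSpace ℝ d} (hbc : Continuous b) (hdiv : IsWeaklyDivFree b) {Λ : ℝ} (hΛ : 0 ≤ Λ)
    (hbL : ∀ x y, ‖b x - b y‖ ≤ Λ * ‖reprc (x - y)‖)
    {u : UnitAddTorus d → EuclideanSpace ℝ d} (hu : MemLp u 2 volume)
    {W : ℕ → ℝ} (hW : ∀ n, 1 ≤ n → n ≤ ℓ → ∀ x, ‖b x - fourierTruncate (n * S - 2 * Δ) b x‖ ≤ W n) :
    |∫ x, ⟪u x, convect b (realTrigPoly (ladderSupp d K₀ S Δ)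
        (fun k => (((rungSym K₀ S Δ ℓ k) ^ 2 : ℝ) : ℂ) • mFourierCoeff (EuclideanSpace.complexify ∘ u) k)) x⟫_ℝ| ≤
      2 * Real.pi * (rungHeight K₀ S ℓ + 2 * Δ) * Real.sqrt (rungEnergy K₀ S Δ ℓ u) *
        (2 * (Fintype.card d) ^ 2 * Λ / Δ * Real.sqrt (rungEnergy K₀ S Δ (ℓ - 1) u) +
          Fintype.card d * ∑ i ∈ Finset.range (ℓ - 1), W (ℓ - 1 - i) * Real.sqrt (rungEnergy K₀ S Δ i u) +
          Fintype.card d * W ℓ * Real.sqrt (∫ x, ‖u x‖ ^ 2)) := by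
  classical
  obtain ⟨ℓ', rfl⟩ : ∃ ℓ', ℓ = ℓ' + 1 := ⟨ℓ - 1, by omega⟩
  simp only [Nat.add_sub_cancel]
  -- ### notation
  set F : Finset (d → ℤ) := ladderSupp d K₀ S Δ with hF
  set X : (d → ℤ) → EuclideanSpace ℂ d := mFourierCoeff (EuclideanSpace.complexify ∘ u) with hX
  set H : ℕ := rungHeight K₀ S (ℓ' + 1) with hH
  set Fl : Finset (d → ℤ) := cubeSupp d (H + 2 * Δ) with hFl
  set P : ℕ → UnitAddTorus d → EuclideanSpace ℝ d := fun i => rungProj K₀ S Δ i u with hP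
  have hui : Integrable u volume := hu.integrable one_le_two
  have hXc : IsConjSymm X := isConjSymm_mFourierCoeff hui
  have hLsym : ∀ m ∈ F, -m ∈ F := fun m hm => neg_mem_ladderSupp hm
  have hFlsym : ∀ k ∈ Fl, -k ∈ Fl := fun k hk => neg_mem_cubeSupp hk
  have hba : ∀ a, Continuous fun x => b x a := fun a => (PiLp.continuous_apply 2 (fun _ : d => ℝ) a).comp hbc
  have hPm : ∀ i, MemLp (P i) 2 volume := fun i => memLp_realTrigPoly (ladderSupp d K₀ S Δ) _ 2
  have hχℓ : ∀ k : d → ℤ, rungSym K₀ S Δ (ℓ' + 1) k = cubeSym H Δ k := fun k => rfl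
  -- the test field lives on the small cube `Fl`
  have htest : realTrigPoly F (fun k => (((rungSym K₀ S Δ (ℓ' + 1) k) ^ 2 : ℝ) : ℂ) • X k) =
      realTrigPoly Fl (fun k => (((cubeSym H Δ k) ^ 2 : ℝ) : ℂ) • X k) := by
    refine realTrigPoly_eq_of_vanish (fun k _ hk => ?_) (fun k _ hk => ?_)
    · rw [hχℓ, cubeSym_eq_zero_of_not_mem hk]; simp
    · show (((rungSym K₀ S Δ (ℓ' + 1) k) ^ 2 : ℝ) : ℂ) • X k = 0
      rw [rungSym_eq_zero_of_not_mem hk]; simp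
  rw [htest]
  -- ### Step 1: bulk + remainder
  have hχχ' : ∀ k : d → ℤ, rungSym K₀ S Δ ℓ' k * cubeSym H Δ k = cubeSym H Δ k := fun k => by
    rw [← hχℓ]; exact rungSym_mul_succ (K₀ := K₀) hΔ hS hℓ k
  have hmain := abs_cubeFlux_sub_remainder_le H hΔ hbc hdiv hΛ hbL hu (χ' := rungSym K₀ S Δ ℓ') (F' := F) hLsym
    (fun k hk => rungSym_eq_zero_of_not_mem hk) (fun k => by simp only [rungSym, cubeSym_neg]) hχχ'
  rw [sum_cubeSupp_rung_eq_rungEnergy] at hmain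
  -- the bulk bound in the target form
  have hEprev : Real.sqrt (∑ k ∈ F, ‖((rungSym K₀ S Δ ℓ' k : ℝ) : ℂ) • X k‖ ^ 2) = Real.sqrt (rungEnergy K₀ S Δ ℓ' u) := rfl
  rw [hEprev] at hmain
  -- ### Step 2: remainder, axis by axis
  have hΦ : ∀ a, (fun k : d → ℤ => (2 * Real.pi * Complex.I * (k a)) • ((((cubeSym H Δ k) ^ 2 : ℝ) : ℂ) • X k)) =
      rungTestCoeff K₀ S Δ (ℓ' + 1) u a := fun a => rfl
  have hΦc : ∀ a, IsConjSymm (rungTestCoeff K₀ S Δ (ℓ' + 1) u a) := fun a => isConjSymm_rungTestCoeff hui _ a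
  have hΦn : ∀ a, Real.sqrt (∑ k ∈ Fl, ‖rungTestCoeff K₀ S Δ (ℓ' + 1) u a k‖ ^ 2) ≤
      2 * Real.pi * (H + 2 * Δ) * Real.sqrt (rungEnergy K₀ S Δ (ℓ' + 1) u) := fun a => sqrt_sum_rungTestCoeff_le _ u a
  have hmain' : |(∫ x, ⟪u x, convect b (realTrigPoly Fl (fun k => (((cubeSym H Δ k) ^ 2 : ℝ) : ℂ) • X k)) x⟫_ℝ) -
      ∑ a, ∫ x, b x a * ⟪u x - P ℓ' x, realTrigPoly Fl (rungTestCoeff K₀ S Δ (ℓ' + 1) u a) x⟫_ℝ| ≤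
      4 * Real.pi * (Fintype.card d) ^ 2 * Λ * (H + 2 * Δ) / Δ * Real.sqrt (rungEnergy K₀ S Δ ℓ' u) *
        Real.sqrt (rungEnergy K₀ S Δ (ℓ' + 1) u) := hmain
  -- telescoping of the low part: `u − P ℓ' = (u − P 0) + Σ_{i<ℓ'} (P i − P (i+1))`
  have htel : ∀ x, u x - P ℓ' x = (u - P 0) x + ∑ i ∈ Finset.range ℓ', (P i - P (i + 1)) x := by
    intro x; simp only [Pi.sub_apply]; rw [Finset.sum_range_sub' (fun i => P i x)]; abel
  have hrem : ∀ a, |∫ x, b x a * ⟪u x - P ℓ' x, realTrigPoly Fl (rungTestCoeff K₀ S Δ (ℓ' + 1) u a) x⟫_ℝ| ≤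
      (∑ i ∈ Finset.range ℓ', W (ℓ' - i) * Real.sqrt (rungEnergy K₀ S Δ i u) + W (ℓ' + 1) * Real.sqrt (∫ x, ‖u x‖ ^ 2)) *
        (2 * Real.pi * (H + 2 * Δ) * Real.sqrt (rungEnergy K₀ S Δ (ℓ' + 1) u)) := by
    intro a
    set Φ := realTrigPoly Fl (rungTestCoeff K₀ S Δ (ℓ' + 1) u a) with hΦdef
    have hΦcont : Continuous Φ := continuous_realTrigPoly _ _
    have hI : ∀ v : UnitAddTorus d → EuclideanSpace ℝ d, MemLp v 2 volume →
        Integrable (fun x => b x a * ⟪v x, Φ x⟫_ℝ) volume := fun v hv => integrable_mul_inner hv (hba a) hΦcont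
    have hsplit : (∫ x, b x a * ⟪u x - P ℓ' x, Φ x⟫_ℝ) = (∫ x, b x a * ⟪(u - P 0) x, Φ x⟫_ℝ) +
        ∑ i ∈ Finset.range ℓ', ∫ x, b x a * ⟪(P i - P (i + 1)) x, Φ x⟫_ℝ := by
      rw [← integral_finsetSum _ fun i _ => hI (P i - P (i + 1)) ((hPm i).sub (hPm (i + 1))),
        ← integral_add (hI (u - P 0) (hu.sub (hPm 0)))
          (integrable_finsetSum _ fun i _ => hI (P i - P (i + 1)) ((hPm i).sub (hPm (i + 1))))]
      refine integral_congr_ae (ae_of_all _ fun x => ?_)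
      dsimp only
      rw [htel x, inner_add_left, sum_inner, mul_add, Finset.mul_sum]
    rw [hsplit, add_mul, add_comm]
    refine (abs_add_le _ _).trans (add_le_add ?_ ?_)
    · -- the rung pieces
      refine (Finset.abs_sum_le_sum_abs _ _).trans ?_
      rw [Finset.sum_mul]
      refine Finset.sum_le_sum fun i hi => ?_
      rw [Finset.mem_range] at hi
      have hn1 : 1 ≤ ℓ' - i := by omega
      have hin : i + 1 + (ℓ' - i) = ℓ' + 1 := by omega
      have hvan : ∀ y ∈ freqBall (d := d) ((ℓ' - i) * S - 2 * Δ), ∀ k ∈ Fl,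
          mFourierCoeff (EuclideanSpace.complexify ∘ (P i - P (i + 1))) (y + k) = 0 := fun y hy k hk =>
        mFourierCoeff_rungPiece_eq_zero (K₀ := K₀) hΔ hS hn1 hin hℓ hui hy hk
      have hε : ∀ x, |b x a - realTrigPoly (freqBall ((ℓ' - i) * S - 2 * Δ)) (mFourierCoeff (EuclideanSpace.complexify ∘ b)) x a| ≤
          W (ℓ' - i) := fun x => by
        rw [← fourierTruncate_eq]
        exact (by simpa using PiLp.norm_apply_le (b x - fourierTruncate ((ℓ' - i) * S - 2 * Δ) b x) a :
          |b x a - fourierTruncate ((ℓ' - i) * S - 2 * Δ) b x a| ≤ ‖b x - fourierTruncate ((ℓ' - i) * S - 2 * Δ) b x‖).trans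
          (hW _ hn1 (by omega) x)
      have htail := abs_integral_mul_inner_realTrigPoly_le_of_coeff_vanish ((hPm i).sub (hPm (i + 1))) (hba a)
        neg_mem_freqBall_of_mem hFlsym (isConjSymm_mFourierCoeff hbc.integrable_unitAddTorus) (hΦc a) a hvan hε
      refine htail.trans ?_
      have hW0 : 0 ≤ W (ℓ' - i) := (abs_nonneg _).trans (hε 0)
      have hvn : Real.sqrt (∫ x, ‖(P i - P (i + 1)) x‖ ^ 2) ≤ Real.sqrt (rungEnergy K₀ S Δ i u) :=
        Real.sqrt_le_sqrt (integral_norm_sq_rungPiece_le (K₀ := K₀) hΔ hS (le_trans (Nat.mul_le_mul_right _ (by omega)) hℓ) hui)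
      exact mul_le_mul (mul_le_mul_of_nonneg_left hvn hW0) (hΦn a) (Real.sqrt_nonneg _) (mul_nonneg hW0 (Real.sqrt_nonneg _))
    · -- the top piece
      have hvan : ∀ y ∈ freqBall (d := d) ((ℓ' + 1) * S - 2 * Δ), ∀ k ∈ Fl,
          mFourierCoeff (EuclideanSpace.complexify ∘ (u - P 0)) (y + k) = 0 := fun y hy k hk =>
        mFourierCoeff_topPiece_eq_zero (K₀ := K₀) hΔ hS (by omega) hℓ hui hy hk
      have hε : ∀ x, |b x a - realTrigPoly (freqBall ((ℓ' + 1) * S - 2 * Δ)) (mFourierCoeff (EuclideanSpace.complexify ∘ b)) x a| ≤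
          W (ℓ' + 1) := fun x => by
        rw [← fourierTruncate_eq]
        exact (by simpa using PiLp.norm_apply_le (b x - fourierTruncate ((ℓ' + 1) * S - 2 * Δ) b x) a :
          |b x a - fourierTruncate ((ℓ' + 1) * S - 2 * Δ) b x a| ≤ ‖b x - fourierTruncate ((ℓ' + 1) * S - 2 * Δ) b x‖).trans
          (hW _ (by omega) le_rfl x)
      have htail := abs_integral_mul_inner_realTrigPoly_le_of_coeff_vanish (hu.sub (hPm 0)) (hba a)
        neg_mem_freqBall_of_mem hFlsym (isConjSymm_mFourierCoeff hbc.integrable_unitAddTorus) (hΦc a) a hvan hε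
      refine htail.trans ?_
      have hW0 : 0 ≤ W (ℓ' + 1) := (abs_nonneg _).trans (hε 0)
      have hvn : Real.sqrt (∫ x, ‖(u - P 0) x‖ ^ 2) ≤ Real.sqrt (∫ x, ‖u x‖ ^ 2) :=
        Real.sqrt_le_sqrt (integral_norm_sq_sub_rungProj_zero_le (K₀ := K₀) hu)
      exact mul_le_mul (mul_le_mul_of_nonneg_left hvn hW0) (hΦn a) (Real.sqrt_nonneg _) (mul_nonneg hW0 (Real.sqrt_nonneg _))
  -- ### Step 3: assemble
  have hsumrem : |∑ a, ∫ x, b x a * ⟪u x - P ℓ' x, realTrigPoly Fl (rungTestCoeff K₀ S Δ (ℓ' + 1) u a) x⟫_ℝ| ≤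
      Fintype.card d * ((∑ i ∈ Finset.range ℓ', W (ℓ' - i) * Real.sqrt (rungEnergy K₀ S Δ i u) +
        W (ℓ' + 1) * Real.sqrt (∫ x, ‖u x‖ ^ 2)) * (2 * Real.pi * (H + 2 * Δ) * Real.sqrt (rungEnergy K₀ S Δ (ℓ' + 1) u))) := by
    refine (Finset.abs_sum_le_sum_abs _ _).trans ?_
    refine (Finset.sum_le_sum fun a _ => hrem a).trans ?_
    rw [Finset.sum_const, Finset.card_univ, nsmul_eq_mul]
  have h3 := (abs_sub_abs_le_abs_sub _ _).trans hmain'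
  have hfin := add_le_add h3 hsumrem
  rw [sub_add_cancel] at hfin
  refine hfin.trans_eq ?_
  ring

end RungFlux


/-! ## §13b Small tools for the time-dependent descent -/

section DescentTools

open EuclideanSpace

variable {K₀ S Δ : ℕ}

omit [Fintype d] [DecidableEq d] in
/-- Rungs `ℓ ≥ 1` sit at height at most `K₀`. [cite: DiPernaLions1989, §II.1 Lemma II.1] -/
theorem rungHeight_succ_le (ℓ : ℕ) : rungHeight K₀ S (ℓ + 1) ≤ K₀ := by
  unfold rungHeight; rw [Nat.succ_mul]; omega

/-- The rung energy as a weighted sum of squared Fourier coefficients. [cite: Grafakos2014, Prop. 3.2.7 (3)] -/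
theorem rungEnergy_eq_sum_mul (i : ℕ) (u : UnitAddTorus d → EuclideanSpace ℝ d) :
    rungEnergy K₀ S Δ i u = ∑ k ∈ ladderSupp d K₀ S Δ,
      rungSym K₀ S Δ i k ^ 2 * ‖mFourierCoeff (EuclideanSpace.complexify ∘ u) k‖ ^ 2 := by
  refine Finset.sum_congr rfl fun k _ => ?_
  rw [norm_smul, Complex.norm_real, Real.norm_eq_abs, mul_pow, sq_abs]

/-- The rung energy is at most the total energy: `E_i(u) ≤ ‖u‖₂²` (`0 ≤ rungSym ≤ 1`, Parseval).
[cite: Grafakos2014, Prop. 3.2.7 (3)] -/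
theorem rungEnergy_le_integral_norm_sq (i : ℕ) {u : UnitAddTorus d → EuclideanSpace ℝ d} (hu : MemLp u 2 volume) :
    rungEnergy K₀ S Δ i u ≤ ∫ x, ‖u x‖ ^ 2 := by
  rw [rungEnergy_eq_sum_mul]
  refine le_trans (Finset.sum_le_sum fun k _ => ?_)
    (sum_le_hasSum _ (fun k _ => sq_nonneg _) (hasSum_sq_norm_mFourierCoeff_complexify hu))
  have h0 : 0 ≤ rungSym K₀ S Δ i k := cubeSym_nonneg _ _ _
  have h1 : rungSym K₀ S Δ i k ≤ 1 := cubeSym_le_one _ _ _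
  have : rungSym K₀ S Δ i k ^ 2 ≤ 1 := by nlinarith
  exact (mul_le_of_le_one_left (sq_nonneg _) this)

omit [DecidableEq d] in
/-- A real-weighted sum of single real modes is the real trigonometric polynomial with the weighted coefficients:
`Σ_{k∈F} ω_k Re(e_k • c_k) = realTrigPoly F (ω • c)`. [cite: Grafakos2014, Prop. 3.2.5] -/
theorem sum_smul_realTrigPoly_singleton (F : Finset (d → ℤ)) (ω : (d → ℤ) → ℝ) (c : (d → ℤ) → EuclideanSpace ℂ d) :
    (fun y => ∑ k ∈ F, ω k • realTrigPoly {k} c y) = realTrigPoly F (fun k => ((ω k : ℝ) : ℂ) • c k) := by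
  classical
  funext y
  rw [realTrigPoly_apply_eq_sum]
  refine Finset.sum_congr rfl fun k _ => ?_
  rw [realTrigPoly_singleton_apply, smul_comm (mFourier k y) ((ω k : ℝ) : ℂ) (c k), Complex.coe_smul]
  exact (map_smul EuclideanSpace.realPart (ω k) (mFourier k y • c k)).symm

omit [Fintype d] [DecidableEq d] in
/-- **Ladder bookkeeping.**  If `e_i ≤ M x^{-i}` for `i ≤ ℓ` and `e' ≤ M`, then for `x ≥ 1`, `W ≥ 0`, `ℓ ≤ J`,
`a e_ℓ + D Σ_{i<ℓ} W(ℓ−i) e_i + D W(ℓ+1) e' ≤ M x^{-ℓ} (a + D Σ_{n≤J} W(n+1) x^{n+1})`.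
[cite: DiPernaLions1989, §II.1 Lemma II.1] -/
theorem ladder_bracket_le {ℓ J : ℕ} (hℓ : ℓ ≤ J) {x M a D : ℝ} (hx : 1 ≤ x) (hM : 0 ≤ M) (ha : 0 ≤ a) (hD : 0 ≤ D)
    {W : ℕ → ℝ} (hW : ∀ n, 0 ≤ W n) {e : ℕ → ℝ} (he : ∀ i, i ≤ ℓ → e i ≤ M * x⁻¹ ^ i) {e' : ℝ} (he' : e' ≤ M) :
    a * e ℓ + D * ∑ i ∈ Finset.range ℓ, W (ℓ - i) * e i + D * W (ℓ + 1) * e' ≤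
      M * x⁻¹ ^ ℓ * (a + D * ∑ n ∈ Finset.range (J + 1), W (n + 1) * x ^ (n + 1)) := by
  have hx0 : 0 < x := by linarith
  have hxi : ∀ i : ℕ, x⁻¹ ^ i = x⁻¹ ^ ℓ * x ^ (ℓ - i) ∨ ℓ < i := by
    intro i
    by_cases h : i ≤ ℓ
    · left
      obtain ⟨m, rfl⟩ := Nat.exists_eq_add_of_le h
      rw [Nat.add_sub_cancel_left, pow_add, mul_assoc, ← mul_pow, inv_mul_cancel₀ hx0.ne', one_pow, mul_one]
    · right; omega
  -- term 1
  have h1 : a * e ℓ ≤ M * x⁻¹ ^ ℓ * a := by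
    have := he ℓ le_rfl
    nlinarith
  -- term 2: reindex `i ↦ ℓ - i`
  have h2 : ∑ i ∈ Finset.range ℓ, W (ℓ - i) * e i ≤ M * x⁻¹ ^ ℓ * ∑ n ∈ Finset.range ℓ, W (n + 1) * x ^ (n + 1) := by
    rw [Finset.mul_sum, ← Finset.sum_range_reflect (fun n => M * x⁻¹ ^ ℓ * (W (n + 1) * x ^ (n + 1))) ℓ]
    refine Finset.sum_le_sum fun i hi => ?_
    rw [Finset.mem_range] at hi
    have e1 : ℓ - 1 - i + 1 = ℓ - i := by omega
    rw [e1]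
    rcases hxi i with h | h
    · have := he i hi.le
      calc W (ℓ - i) * e i ≤ W (ℓ - i) * (M * x⁻¹ ^ i) := mul_le_mul_of_nonneg_left this (hW _)
        _ = M * x⁻¹ ^ ℓ * (W (ℓ - i) * x ^ (ℓ - i)) := by rw [h]; ring
    · omega
  -- term 3
  have h3 : W (ℓ + 1) * e' ≤ M * x⁻¹ ^ ℓ * (W (ℓ + 1) * x ^ (ℓ + 1)) := by
    have hxx : (1 : ℝ) ≤ x⁻¹ ^ ℓ * x ^ (ℓ + 1) := by
      rw [pow_succ, ← mul_assoc, ← mul_pow, inv_mul_cancel₀ hx0.ne', one_pow, one_mul]; exact hx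
    calc W (ℓ + 1) * e' ≤ W (ℓ + 1) * M := mul_le_mul_of_nonneg_left he' (hW _)
      _ = W (ℓ + 1) * M * 1 := (mul_one _).symm
      _ ≤ W (ℓ + 1) * M * (x⁻¹ ^ ℓ * x ^ (ℓ + 1)) := mul_le_mul_of_nonneg_left hxx (mul_nonneg (hW _) hM)
      _ = _ := by ring
  -- the partial sum over `n < ℓ + 1` is at most the full sum over `n < J + 1`
  have h4 : ∑ n ∈ Finset.range ℓ, W (n + 1) * x ^ (n + 1) + W (ℓ + 1) * x ^ (ℓ + 1) ≤
      ∑ n ∈ Finset.range (J + 1), W (n + 1) * x ^ (n + 1) := by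
    rw [← Finset.sum_range_succ]
    exact Finset.sum_le_sum_of_subset_of_nonneg (Finset.range_mono (by omega)) fun n _ _ =>
      mul_nonneg (hW _) (pow_nonneg hx0.le _)
  have hMx : 0 ≤ M * x⁻¹ ^ ℓ := mul_nonneg hM (pow_nonneg (inv_nonneg.2 hx0.le) _)
  nlinarith [mul_le_mul_of_nonneg_left h2 hD, mul_le_mul_of_nonneg_left h3 hD,
    mul_le_mul_of_nonneg_left (mul_le_mul_of_nonneg_left h4 hD) hMx]

end DescentTools

end Torus
end Literature.Analysis.FunctionSpaces

end
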